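import Summits.QuantumFields.YangMills.Theorems.BalabanUVNodesN15CovariantLandauCovariance
import Summits.QuantumFields.YangMills.Theorems.BalabanUVNodesN15CurvedGaugeCovariance
import HarnessLib

/-!
# Route «BalabanUVNodes», node N15 = NE2, road (c) — PROGRAMME (P-R), V: THE GAUGE COVARIANCE OF THE COVARIANT BLOCK-LINE AVERAGING `Q(U)`, `Q*(U)` OF COLOURED 1-FORMS —
# (3.32) for n15-c∕181's `qvCov`∕`qvCovAdj`: `Q(U^u) = M_{W∘base}·Q(U)·M_{Wᵀ}`, `Q*(U^u) = M_W·Q*(U)·M_{(W∘base)ᵀ}`, `Q*(U^u)Q(U^u) = M_W·Q*(U)Q(U)·M_{Wᵀ}` (dag-n15-c g22, n15-c∕201a)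

Cell `pub-ymgap`, seat `pub-ymgap-dag-n15-c` (generation g22; R134 (a), s1; HUMAN RULING D-0062; chair R424 venue).  `bears_on: R4∕N15 · K3⁸ SpineGivenEndpointR13SepCoPHV
(stmt-QuantumFields-27366)`; filed `--supports stmt-QuantumFields-27366 --as helper` — COUNT-NEUTRAL.  Finite algebra ([folklore]); no `def`; 0 `sorry`; NO estimate.  Imports BY NAME
n15-c∕198 `…N15CovariantLandauCovariance` (`gaugeTb`, ★ `cvaPath_gauge`; through it n15-c∕181 `qvKer`∕`qvAdjKer`∕`qvCov`∕`qvCovAdj` and their `_apply` lemmas) and the lane's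
`…N15CurvedGaugeCovariance` (`mmulOp_transpose_comp`; through it `…N15VectorCarrier`'s `mmulOp`, `mmulOp_apply`).  Nothing in the tree modified ∕ restated.

WHY.  The cover knit's conjugation row `hP` (FILE 120 `uN_cvGlued_spec`: `M_{W_k}·P·M_{W_kᵀ} = N_L ⊗ 1 − N_V k`) for the FULLY covariant summand `P(U) = a·Q*(U)Q(U) − D_U(I−R(U))D*_U`
(n15-c∕183's averaging summand + n15-c∕197's Landau summand) with the per-cube gauge `u_k` LIVE needs BOTH summands to be conjugated under `U ↦ U^{u_k}`.  The Landau summand is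
n15-c∕198 `landauCov_gauge`; THIS FILE is the averaging summand: [Balaban1985BackgroundPropagators] p. 396 l. 1–3 *«Finally inspecting the definitions of the averaging operators
Q_j(U) for gauge fields we can see that the equalities (3.32) hold again»* — in the model, with the site gauge `W` (`= coordMat e Ad_{u(x)}`) acting on fine coloured 1-forms by `M_W`
at the bond's base point, on coarse ones by `M_{W∘base}` at the block's base point `n·y`, and on the bond-indexed transporters by n15-c∕198's `gaugeTb`.

RESULTS ([folklore] algebra; (3.32) tags mark the printed law transcribed in the model).
* §1 generic kernels: `blockCoords_fst_of_mem_fibre`, ★ `qvKer_conj` (a kernel conjugated by `A(block)` on the left and `B(far end)ᵀ` on the right gives `M_A·Q_K·M_{Bᵀ}`),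
  ★ `qvAdjKer_conj` (the adjoint shape: `M_B·Q*_K·M_{Aᵀ}`).
* §2 ★ `qvCov_gauge : qvCov (T^W) = M_{W∘base}·qvCov T·M_{Wᵀ}` ((3.32)), ★ `qvCovAdj_gauge : qvCovAdj (T^W) = M_W·qvCovAdj T·M_{(W∘base)ᵀ}`,
  ★★ **`qvCovAdj_comp_qvCov_gauge : Q*(T^W)∘Q(T^W) = M_W·(Q*(T)∘Q(T))·M_{Wᵀ}`** (the averaging summand's `hP` row with the gauge LIVE; `W` fibrewise orthogonal).

HONEST FRAMING ∕ LIMITS.  Algebra only; no estimate; MODEL READING as n15-c∕181 (main term (125) of [Balaban1985Averaging] (124), one-level staircases) and n15-c∕198 (site,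
component-blind gauges).  NOT [Balaban1985BackgroundPropagators] Thms 3.1–3.3; NE2⁺ NOT PRINTED; N15 of record untouched (DISCHARGED AS CONSUMED, p687738); counts UNMOVED
(typed 28∕28); one finite 𝕋⁴ at fixed ε per index — NOT infinite volume ∕ OS ∕ mass gap ∕ Clay.  Restate-immune (no Theses import).
-/

noncomputable section

open scoped BigOperators Matrix
open Finset

namespace Summit.QuantumFields.YangMills.BalabanUVNodes.N15.CovAvg

open Literature.MathematicalPhysics.QuantumFieldTheory.Balaban1983to89
open Literature.MathematicalPhysics.QuantumFieldTheory.Balaban1983to89.B5Prop11Plancherel (Tor fine unitVec)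
open Literature.MathematicalPhysics.QuantumFieldTheory.Balaban1983to89.B5Block118 (bpt)
open Literature.MathematicalPhysics.QuantumFieldTheory.Balaban1983to89.T4EtaRateCoeffDefect (fibre mem_fibre)
open Literature.MathematicalPhysics.QuantumFieldTheory.King1986.Torus (blockOf)
open Summit.QuantumFields.YangMills.BalabanUVNodes.N15.VectorPiece (blockCoords blockCoords_bpt bpt_blockCoords)
open Summit.QuantumFields.YangMills.BalabanUVNodes.N15.DefectKernel (kingBlockOf_bpt)
open Summit.QuantumFields.YangMills.BalabanUVNodes.N15.MatrixSpecies (mmulOp mmulOp_apply)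
open Summit.QuantumFields.YangMills.BalabanUVNodes.N15.CovLandau (gaugeTb cvaPath_gauge conj_apply)

variable {d : ℕ} (M : Fin (d + 1) → ℕ) [∀ μ, NeZero (M μ)] (n : ℕ) [NeZero n] {ι : Type} [Fintype ι] [DecidableEq ι]

/-! ## §1 Conjugated kernels -/

section Kernels

omit [DecidableEq ι] [Fintype ι] in
/-- In the block of `y` the block coordinate is `y`. [folklore] -/
theorem blockCoords_fst_of_mem_fibre {y : Tor M} {x : Tor (fine n M)} (hx : x ∈ fibre (blockOf n M) y) : (blockCoords n M x).1 = y := by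
  rw [mem_fibre] at hx
  rw [← hx, ← bpt_blockCoords n M x, kingBlockOf_bpt, bpt_blockCoords]

omit M n [∀ μ, NeZero (M μ)] [NeZero n] [DecidableEq ι] in
/-- Colour bookkeeping (row form): `Σ_j (A K Bᵀ)_{ij} w_j = Σ_{i′} A_{ii′} Σ_{j′} K_{i′j′} Σ_j B_{jj′} w_j`. [folklore] -/
theorem sum_conj_mul_vec (A K B : Matrix ι ι ℝ) (w : ι → ℝ) (i : ι) :
    ∑ j, (A * K * Bᵀ) i j * w j = ∑ i', A i i' * ∑ j', K i' j' * ∑ j, B j j' * w j := by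
  change ((A * K * Bᵀ) *ᵥ w) i = _
  rw [← Matrix.mulVec_mulVec, ← Matrix.mulVec_mulVec]
  rfl

omit M n [∀ μ, NeZero (M μ)] [NeZero n] [DecidableEq ι] in
/-- Colour bookkeeping (column form): `Σ_i (A K Bᵀ)_{ij} w_i = Σ_{j′} B_{jj′} Σ_{i′} K_{i′j′} Σ_i A_{ii′} w_i`. [folklore] -/
theorem sum_conj_mul_vec' (A K B : Matrix ι ι ℝ) (w : ι → ℝ) (j : ι) :
    ∑ i, (A * K * Bᵀ) i j * w i = ∑ j', B j j' * ∑ i', K i' j' * ∑ i, A i i' * w i := by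
  change ((A * K * Bᵀ)ᵀ *ᵥ w) j = _
  rw [Matrix.transpose_mul, Matrix.transpose_mul, Matrix.transpose_transpose, ← Matrix.mulVec_mulVec, ← Matrix.mulVec_mulVec]
  rfl

omit M n [∀ μ, NeZero (M μ)] [NeZero n] [DecidableEq ι] [Fintype ι] in
/-- Pulling a colour factor through a scaled sum: `c·Σ_s Σ_{i′} a_{i′} f_s(i′) = Σ_{i′} a_{i′}·(c·Σ_s f_s(i′))`. [folklore] -/
theorem mul_sum_sum_pull {α β : Type} (S : Finset α) (T : Finset β) (c : ℝ) (a : β → ℝ) (f : α → β → ℝ) :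
    c * ∑ s ∈ S, ∑ i' ∈ T, a i' * f s i' = ∑ i' ∈ T, a i' * (c * ∑ s ∈ S, f s i') := by
  simp only [Finset.mul_sum]
  rw [Finset.sum_comm]
  exact Finset.sum_congr rfl fun i' _ => Finset.sum_congr rfl fun s _ => by ring

omit [DecidableEq ι] in
/-- ★ A KERNEL CONJUGATED by a coarse-site matrix `A` at the block (left) and a fine-site matrix `Bᵀ` at the far end of the line (right) gives the conjugated average:
`Q_{A·K·Bᵀ} = M_A ∘ Q_K ∘ M_{Bᵀ}`. [folklore] -/
theorem qvKer_conj (A : Tor M → Matrix ι ι ℝ) (B : Tor (fine n M) → Matrix ι ι ℝ) (K : Tor (fine n M) × Fin (d + 1) → ℕ → Matrix ι ι ℝ) :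
    qvKer M n (fun p s => A (blockCoords n M p.1).1 * K p s * (B (p.1 + s • unitVec (fine n M) p.2))ᵀ) =
      mmulOp (fun q : Tor M × Fin (d + 1) => A q.1) ∘ₗ qvKer M n K ∘ₗ mmulOp (fun p : Tor (fine n M) × Fin (d + 1) => (B p.1)ᵀ) := by
  refine LinearMap.ext fun u => funext fun q => ?_
  obtain ⟨⟨y, μ⟩, i⟩ := q
  simp only [LinearMap.comp_apply, mmulOp_apply, qvKer_apply, Matrix.transpose_apply]
  have hL : ∀ x ∈ fibre (blockOf n M) y, ((n : ℝ)⁻¹ * ∑ s ∈ range n, ∑ j, (A (blockCoords n M x).1 * K (x, μ) s * (B (x + s • unitVec (fine n M) μ))ᵀ) i j *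
        u ((x + s • unitVec (fine n M) μ, μ), j)) =
      ∑ i', A y i i' * ((n : ℝ)⁻¹ * ∑ s ∈ range n, ∑ j', K (x, μ) s i' j' * ∑ j, B (x + s • unitVec (fine n M) μ) j j' * u ((x + s • unitVec (fine n M) μ, μ), j)) := by
    intro x hx
    rw [blockCoords_fst_of_mem_fibre M n hx]
    simp only [sum_conj_mul_vec]
    exact mul_sum_sum_pull _ _ _ _ _
  rw [Finset.sum_congr rfl hL]
  exact mul_sum_sum_pull _ _ _ _ _

omit [DecidableEq ι] in
/-- ★ THE ADJOINT SHAPE: `Q*_{A·K·Bᵀ} = M_B ∘ Q*_K ∘ M_{Aᵀ}` (the colour index of the kernel is transposed in `qvAdjKer`). [folklore] -/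
theorem qvAdjKer_conj (A : Tor M → Matrix ι ι ℝ) (B : Tor (fine n M) → Matrix ι ι ℝ) (K : Tor (fine n M) × Fin (d + 1) → ℕ → Matrix ι ι ℝ) :
    qvAdjKer M n (fun p s => A (blockCoords n M p.1).1 * K p s * (B (p.1 + s • unitVec (fine n M) p.2))ᵀ) =
      mmulOp (fun p : Tor (fine n M) × Fin (d + 1) => B p.1) ∘ₗ qvAdjKer M n K ∘ₗ mmulOp (fun q : Tor M × Fin (d + 1) => (A q.1)ᵀ) := by
  refine LinearMap.ext fun v => funext fun p => ?_
  obtain ⟨⟨x, κ⟩, j⟩ := p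
  simp only [LinearMap.comp_apply, mmulOp_apply, qvAdjKer_apply, sub_add_cancel, Matrix.transpose_apply]
  have hb : ∀ s : ℕ, (blockCoords n M (x - s • unitVec (fine n M) κ)).1 = blockOf n M (x - s • unitVec (fine n M) κ) := fun s =>
    blockCoords_fst_of_mem_fibre M n ((mem_fibre _ _ _).mpr rfl)
  simp only [hb, sum_conj_mul_vec']
  exact mul_sum_sum_pull _ _ _ _ _

end Kernels

/-! ## §2 (3.32) for `Q(U)`, `Q*(U)`, and the averaging summand `Q*(U)Q(U)` -/

section Gauge

/-- ★ **(3.32) FOR THE COVARIANT BLOCK-LINE AVERAGE**: `Q(T^W) = M_{W∘base} ∘ Q(T) ∘ M_{Wᵀ}` — «(Q_j(U^u)R(u)λ)(y) = R(u(y))(Q_j(U)λ)(y)» in the model.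
[cite: Balaban1985BackgroundPropagators, (3.32) p.395, p.396 l.1–3] -/
theorem qvCov_gauge {W : Tor (fine n M) → Matrix ι ι ℝ} (hW : ∀ x, (W x)ᵀ * W x = 1) (T : Fin (d + 1) → Tor (fine n M) × Fin (d + 1) → Matrix ι ι ℝ) :
    qvCov M n (gaugeTb M n W T) = mmulOp (fun q : Tor M × Fin (d + 1) => W (bpt n M q.1 0)) ∘ₗ qvCov M n T ∘ₗ mmulOp (fun p : Tor (fine n M) × Fin (d + 1) => (W p.1)ᵀ) := by
  rw [qvCov, qvCov, ← qvKer_conj M n (fun y => W (bpt n M y 0)) W (cvaPath M n T)]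
  congr 1
  funext p s
  exact cvaPath_gauge M n hW T p s

/-- ★ **(3.32) FOR THE WEIGHTED ADJOINT**: `Q*(T^W) = M_W ∘ Q*(T) ∘ M_{(W∘base)ᵀ}`. [cite: Balaban1985BackgroundPropagators, (3.32) p.395, p.396 l.1–3] -/
theorem qvCovAdj_gauge {W : Tor (fine n M) → Matrix ι ι ℝ} (hW : ∀ x, (W x)ᵀ * W x = 1) (T : Fin (d + 1) → Tor (fine n M) × Fin (d + 1) → Matrix ι ι ℝ) :
    qvCovAdj M n (gaugeTb M n W T) = mmulOp (fun p : Tor (fine n M) × Fin (d + 1) => W p.1) ∘ₗ qvCovAdj M n T ∘ₗ mmulOp (fun q : Tor M × Fin (d + 1) => (W (bpt n M q.1 0))ᵀ) := by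
  rw [qvCovAdj, qvCovAdj, ← qvAdjKer_conj M n (fun y => W (bpt n M y 0)) W (cvaPath M n T)]
  congr 1
  funext p s
  exact cvaPath_gauge M n hW T p s

/-- ★★ **THE AVERAGING SUMMAND IS CONJUGATED — FILE 120's `hP` ROW FOR `a·Q*(U)Q(U)` WITH THE GAUGE LIVE**: `Q*(T^W) ∘ Q(T^W) = M_W ∘ (Q*(T) ∘ Q(T)) ∘ M_{Wᵀ}` (the inner
`M_{(W∘base)ᵀ} ∘ M_{W∘base}` cancels by fibrewise orthogonality). [cite: Balaban1985BackgroundPropagators, (3.32)–(3.34) pp.395–396] -/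
theorem qvCovAdj_comp_qvCov_gauge {W : Tor (fine n M) → Matrix ι ι ℝ} (hW : ∀ x, (W x)ᵀ * W x = 1) (T : Fin (d + 1) → Tor (fine n M) × Fin (d + 1) → Matrix ι ι ℝ) :
    qvCovAdj M n (gaugeTb M n W T) ∘ₗ qvCov M n (gaugeTb M n W T) =
      mmulOp (fun p : Tor (fine n M) × Fin (d + 1) => W p.1) ∘ₗ (qvCovAdj M n T ∘ₗ qvCov M n T) ∘ₗ mmulOp (fun p : Tor (fine n M) × Fin (d + 1) => (W p.1)ᵀ) := by
  have hc : mmulOp (fun q : Tor M × Fin (d + 1) => (W (bpt n M q.1 0))ᵀ) ∘ₗ mmulOp (fun q : Tor M × Fin (d + 1) => W (bpt n M q.1 0)) = LinearMap.id :=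
    CurvedSpecies.mmulOp_transpose_comp (W := fun q : Tor M × Fin (d + 1) => W (bpt n M q.1 0)) fun q => hW (bpt n M q.1 0)
  rw [qvCovAdj_gauge M n hW, qvCov_gauge M n hW]
  simp only [LinearMap.comp_assoc]
  rw [← LinearMap.comp_assoc (qvCov M n T ∘ₗ mmulOp fun p : Tor (fine n M) × Fin (d + 1) => (W p.1)ᵀ), hc, LinearMap.id_comp]

end Gauge

end Summit.QuantumFields.YangMills.BalabanUVNodes.N15.CovAvg

end
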